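import Summits.ValiantsHypothesis.ValiantsHypothesis.Theorems.MonotoneRestorationOrbitRestorationQPValueOrbitFinset
import Summits.ValiantsHypothesis.ValiantsHypothesis.Theorems.MonotoneRestorationOrbitRestorationQPRestorable
import Summits.ValiantsHypothesis.ValiantsHypothesis.Theorems.MonotoneRestorationOrbitRestorationQPValueDerivationSubst
import Summits.ValiantsHypothesis.ValiantsHypothesis.Theorems.MonotoneRestorationOrbitRestorationQPValueOrbitDivisionAlgebra
import HarnessLib

/-!
# Quasi-polynomial-orbit restorability is closed under EXACT DIVISION (Strassen's division elimination in orbit currency)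

Route MonotoneRestoration, crux `OrbitRestorationQP` (stmt-ValiantsHypothesis-18293), line `depth_three_rung`
(stub `stub_sigmaPiSigmaValue` = A_∞), namespace `Summit.ValiantsHypothesis.ValiantsHypothesis.Theorems.ValueOrbitDivision`.

The line's currency is `QPOrbitRestorable c n p`: `p` has a square-symmetric circuit over `ℂ` (diagonal `Sym(Fin n)`)
all of whose gate orbits have size `≤ 2^((log₂ n + c)^c)`; by the landed value-orbit form this is the same as an
ordinary straight-line computation all of whose VALUES have small `Sym(Fin n)`-orbits.  The landed closure calculus
(`…ValueOrbitClosure.lean`, `…ValueOrbitFinset.lean`) closes it under scalars, sums and products of any size at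
uniform cost.  This file adds the fourth ring-theoretic operation:

* `qpOrbitRestorable_scale` — SCALING: `p(t·x)` is restorable when `p` is (same level `+ 3`; transport of the value
  derivation along the equivariant substitution `x ↦ t·x`, `…ValueDerivationSubst.lean`);
* `qpOrbitRestorable_of_mul_eq` — **EXACT DIVISION AT UNIFORM COST**: if `F = D · h` with `F`, `D` restorable at
  level `c` and the constant term of `D` nonzero, then the quotient `h` is restorable at level `c + 32` — whatever the
  degrees.  Proof: Strassen's identity (`…ValueOrbitDivisionAlgebra.lean`) writes `h` as a `ℂ`-linear combination of
  `deg P + 1` SCALINGS of `P = d₀⁻¹ · F · Σ_{j ≤ deg h} (1 - d₀⁻¹ D)^j`, a polynomial obtained from `F`, `D` by ring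
  operations; every step is a closure rule of the currency.

Use.  The base point `0` is `Sym(Fin n)`-fixed, so no orbit is enlarged; invariant divisors with `D(0) ≠ 0` (e.g.
`1 + U`, `Π (1 + x_pq)`, products of affine forms with nonzero constant terms) can be divided out of a restorable
product inside the currency.  This is a TOOL for the residue of A_∞ (products of many distinct affine forms with only
global invariance): a factorisation `f = D · g` with `D` restorable reduces `f` to `g`.  No stub is closed; VP ≠ VNP is
not touched. [cite: Strassen1973, Satz 1]
-/

noncomputable section

open scoped Classical
open MvPolynomial

-- `Summit.ValiantsHypothesis.ValiantsHypothesis.…` is the tree's single-conjunct layout (Sub = Summit).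
set_option linter.dupNamespace false

namespace Summit.ValiantsHypothesis.ValiantsHypothesis.Theorems

namespace ValueOrbitDivision

open Literature.Computability.AlgebraicComplexity OrbitRestorationQPDepthThreeRung ValueOrbit

variable {n : ℕ}

/-- Constants are restorable at every level `≥ 3`. [folklore] -/
theorem qpOrbitRestorable_C_add (c : ℕ) (a : ℂ) : QPOrbitRestorable (c + 3) n (C a) := by
  obtain ⟨𝒟, hmem, hS⟩ := exists_valueDerivation_C (n := n) a
  have hB : ∀ q ∈ 𝒟.S, (Set.range fun σ : Equiv.Perm (Fin n) => ren σ q).ncard ≤ 2 ^ ((Nat.log 2 n + c) ^ c) :=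
    fun q hq => (hS q hq).trans Nat.one_le_two_pow
  unfold QPOrbitRestorable
  exact qpOrbit_of_valueDerivation 𝒟 hmem (fun σ => ren_C σ a) hB

/-- **SCALING.**  If `p` is restorable at level `c`, so is `p(t·x)` at level `c + 3`, for every scalar `t`: the value
derivation of `p` is transported along the equivariant substitution `x ↦ t·x` without enlarging value orbits.
[folklore] -/
theorem qpOrbitRestorable_scale {c : ℕ} (t : ℂ) {p : MvPolynomial (Fin n × Fin n) ℂ}
    (hp : QPOrbitRestorable c n p) :
    QPOrbitRestorable (c + 3) n (aeval (fun x : Fin n × Fin n => C t * X x) p) := by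
  obtain ⟨hpi, 𝒟, hmem, hS⟩ := exists_valueDerivation_of_qpOrbitRestorable hp
  obtain ⟨𝒟', hmem', hS'⟩ :=
    ValueDerivation.exists_valueDerivation_scale (Γ := Equiv.Perm (Fin n)) t 𝒟 Nat.one_le_two_pow hS
  have hfix : ∀ σ : Equiv.Perm (Fin n),
      ren σ (aeval (fun x : Fin n × Fin n => C t * X x) p) = aeval (fun x : Fin n × Fin n => C t * X x) p :=
    fun σ => by rw [ValueDerivation.ren_scale_comm, hpi]
  unfold QPOrbitRestorable
  exact qpOrbit_of_valueDerivation 𝒟' (hmem' p hmem) hfix hS'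

/-- Powers at uniform cost: `E^j` is restorable at level `c + 3` when `E` is at level `c`, for every `j`. [folklore] -/
theorem qpOrbitRestorable_pow {c : ℕ} {E : MvPolynomial (Fin n × Fin n) ℂ} (hE : QPOrbitRestorable c n E) (j : ℕ) :
    QPOrbitRestorable (c + 3) n (E ^ j) := by
  have := qpOrbitRestorable_finset_prod (Finset.range j) (fun _ => E) fun _ _ => hE
  rwa [Finset.prod_const, Finset.card_range] at this

/-- Strassen's polynomial `P = d₀⁻¹ · F · Σ_{j < m+1} (1 - d₀⁻¹ D)^j` is restorable at level `c + 23` when `F`, `D` are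
at level `c`. [folklore] -/
theorem qpOrbitRestorable_strassenPoly {c : ℕ} {F D : MvPolynomial (Fin n × Fin n) ℂ}
    (hF : QPOrbitRestorable c n F) (hD : QPOrbitRestorable c n D) (d : ℂ) (m : ℕ) :
    QPOrbitRestorable (c + 23) n (C d * F * ∑ j ∈ Finset.range (m + 1), (1 - C d * D) ^ j) := by
  -- `E = 1 - d·D = C 1 + C (-d) · D` at level `c + 11`
  have hE' : QPOrbitRestorable (c + 8) n (C (-d) * D) :=
    Restorable.qpOrbitRestorable_mono (by omega) (qpOrbitRestorable_smul (-d) hD)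
  have h1 : QPOrbitRestorable (c + 8) n (C (1 : ℂ)) :=
    Restorable.qpOrbitRestorable_mono (by omega) (qpOrbitRestorable_C_add c 1)
  have hE : QPOrbitRestorable (c + 11) n (1 - C d * D) := by
    have h := qpOrbitRestorable_add h1 hE'
    have heq : (C (1 : ℂ) + C (-d) * D : MvPolynomial (Fin n × Fin n) ℂ) = 1 - C d * D := by
      rw [map_neg, map_one]; ring
    rwa [heq] at h
  -- powers and the geometric sum, `c + 17`
  have hS : QPOrbitRestorable (c + 17) n (∑ j ∈ Finset.range (m + 1), (1 - C d * D) ^ j) :=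
    qpOrbitRestorable_finset_sum _ _ fun j _ => qpOrbitRestorable_pow hE j
  -- `C d · F` at `c + 20`, the product at `c + 23`
  have hdF : QPOrbitRestorable (c + 20) n (C d * F) :=
    Restorable.qpOrbitRestorable_mono (by omega) (qpOrbitRestorable_smul d hF)
  exact qpOrbitRestorable_mul hdF (Restorable.qpOrbitRestorable_mono (by omega) hS)

/-- **`QPOrbitRestorable` IS CLOSED UNDER EXACT DIVISION (uniform cost).**  If `F = D · h`, the constant term of `D` is
nonzero, and `F`, `D` have square-symmetric circuits of orbit size `≤ 2^((log₂ n + c)^c)`, then the quotient `h` has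
square-symmetric circuits of orbit size `≤ 2^((log₂ n + c + 32)^(c + 32))` — independently of all degrees.
(Strassen: `h` is a linear combination of scalings `P(t_i·x)`, `t_i = 0, 1, …, N`, of the restorable polynomial `P`.)
[cite: Strassen1973, Satz 1] -/
theorem qpOrbitRestorable_of_mul_eq {c : ℕ} {F D h : MvPolynomial (Fin n × Fin n) ℂ} (hFD : F = D * h)
    (hD0 : constantCoeff D ≠ 0) (hF : QPOrbitRestorable c n F) (hD : QPOrbitRestorable c n D) :
    QPOrbitRestorable (c + 32) n h := by
  set m := h.totalDegree with hm
  set P := C (constantCoeff D)⁻¹ * F *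
    ∑ j ∈ Finset.range (m + 1), (1 - C (constantCoeff D)⁻¹ * D) ^ j with hPdef
  set N := max m P.totalDegree with hN
  let t : Fin (N + 1) → ℂ := fun i => (i : ℕ)
  have ht : Function.Injective t := fun i j hij => Fin.val_injective (Nat.cast_injective (R := ℂ) hij)
  obtain ⟨μ, hμ⟩ := exists_eq_sum_scale_strassen hFD hD0 le_rfl (le_max_left _ _)
    (by rw [← hPdef]; exact le_max_right _ _) t ht
  rw [← hPdef] at hμ
  have hP : QPOrbitRestorable (c + 23) n P := by
    rw [hPdef]; exact qpOrbitRestorable_strassenPoly hF hD _ _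
  have hterm : ∀ i ∈ (Finset.univ : Finset (Fin (N + 1))),
      QPOrbitRestorable (c + 29) n (C (μ i) * aeval (fun x : Fin n × Fin n => C (t i) * X x) P) :=
    fun i _ => qpOrbitRestorable_smul (μ i) (qpOrbitRestorable_scale (t i) hP)
  rw [hμ]
  exact qpOrbitRestorable_finset_sum _ _ hterm

/-- The same with the hypotheses at possibly different levels (take the maximum). [folklore] -/
theorem qpOrbitRestorable_of_mul_eq' {c₁ c₂ : ℕ} {F D h : MvPolynomial (Fin n × Fin n) ℂ} (hFD : F = D * h)
    (hD0 : constantCoeff D ≠ 0) (hF : QPOrbitRestorable c₁ n F) (hD : QPOrbitRestorable c₂ n D) :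
    QPOrbitRestorable (max c₁ c₂ + 32) n h :=
  qpOrbitRestorable_of_mul_eq hFD hD0 (Restorable.qpOrbitRestorable_mono (le_max_left _ _) hF)
    (Restorable.qpOrbitRestorable_mono (le_max_right _ _) hD)

/-- **Family form (the line's currency).**  If `F n = D n · h n` at every level, the `D n` have nonzero constant terms,
and the families `F`, `D` are quasi-polynomially orbit-restorable with one constant each, then so is `h`, with one
constant. [cite: Strassen1973, Satz 1] -/
theorem exists_qpOrbitRestorable_of_mul_eq {F D h : (n : ℕ) → MvPolynomial (Fin n × Fin n) ℂ}
    (hFD : ∀ n, F n = D n * h n) (hD0 : ∀ n, constantCoeff (D n) ≠ 0)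
    (hF : ∃ c : ℕ, ∀ n, QPOrbitRestorable c n (F n)) (hD : ∃ c : ℕ, ∀ n, QPOrbitRestorable c n (D n)) :
    ∃ c : ℕ, ∀ n, QPOrbitRestorable c n (h n) := by
  obtain ⟨c₁, h₁⟩ := hF
  obtain ⟨c₂, h₂⟩ := hD
  exact ⟨max c₁ c₂ + 32, fun n => qpOrbitRestorable_of_mul_eq' (hFD n) (hD0 n) (h₁ n) (h₂ n)⟩

end ValueOrbitDivision

end Summit.ValiantsHypothesis.ValiantsHypothesis.Theorems

end

noncomputable section

open scoped Classical
open MvPolynomial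

set_option linter.dupNamespace false

/-!
## Appendix (appended 2026-08-31, same session): grading, invariant translation, division at an invariant base point

Three more closure rules of `QPOrbitRestorable c n ·`, all at uniform cost and for all degrees:

* `qpOrbitRestorable_homogeneousComponent` — **GRADING**: every homogeneous component `Hom_k p` of a restorable `p` is
  restorable (Vandermonde interpolation from the scalings `p(t·x)`, `t = 0, …, deg p`); so in A_∞ the target family may
  be split into its homogeneous components and reassembled (`qpOrbitRestorable_finset_sum`);
* `qpOrbitRestorable_translate` — **INVARIANT TRANSLATION**: `p(x + a)` is restorable when `p` is and the base point
  `a ∈ ℂ^{n×n}` is fixed by the diagonal action of `Sym(Fin n)` (i.e. `a = α·I + β·(J - I)`);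
* `qpOrbitRestorable_of_mul_eq_of_eval_ne_zero` — **DIVISION AT AN INVARIANT BASE POINT**: if `F = D · h`, `F`, `D`
  restorable and `D(a) ≠ 0` at some `Sym(Fin n)`-fixed `a`, then `h` is restorable (translate to `0`, divide, translate
  back).

Scope (honest): the base point must be FIXED by the diagonal group, so a divisor vanishing on the whole fixed locus
`{α I + β (J - I)}` — e.g. the squared discriminant of the row sums (`WidthSaturation.eval_discRowSq_eq_zero_of_fixed`)
— is not covered; no stub is closed; VP ≠ VNP is not touched. [cite: Strassen1973, Satz 1]
-/

namespace Summit.ValiantsHypothesis.ValiantsHypothesis.Theorems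

namespace ValueOrbitDivision

open Literature.Computability.AlgebraicComplexity OrbitRestorationQPDepthThreeRung ValueOrbit

variable {n : ℕ}

/-! ### Homogeneous components -/

/-- **GRADING.**  Every homogeneous component of a restorable polynomial is restorable, at level `c + 9`, whatever the
degree: `Hom_k p = Σ_i (V⁻¹)_{k i} · p(i·x)` over the scalings by `0, 1, …, deg p`. [folklore] -/
theorem qpOrbitRestorable_homogeneousComponent {c : ℕ} {p : MvPolynomial (Fin n × Fin n) ℂ}
    (hp : QPOrbitRestorable c n p) (k : ℕ) : QPOrbitRestorable (c + 9) n (homogeneousComponent k p) := by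
  by_cases hk : p.totalDegree < k
  · rw [homogeneousComponent_eq_zero _ _ hk, ← C_0]
    exact qpOrbitRestorable_C_add (c + 6) 0
  set N := p.totalDegree with hN
  have hkN : k < N + 1 := by omega
  let t : Fin (N + 1) → ℂ := fun i => (i : ℕ)
  have ht : Function.Injective t := fun i j hij => Fin.val_injective (Nat.cast_injective (R := ℂ) hij)
  rw [homogeneousComponent_eq_sum_inv_vandermonde_scale p le_rfl t ht hkN]
  exact qpOrbitRestorable_finset_sum _ _ fun i _ =>
    qpOrbitRestorable_smul _ (qpOrbitRestorable_scale (t i) hp)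

/-! ### Invariant translations -/

/-- The translation `x ↦ x + a_x` commutes with every renaming under which `a` is invariant. [folklore] -/
theorem ren_translate_comm (a : Fin n × Fin n → ℂ) (ha : ∀ (σ : Equiv.Perm (Fin n)) (x : Fin n × Fin n), a (σ • x) = a x)
    (σ : Equiv.Perm (Fin n)) (q : MvPolynomial (Fin n × Fin n) ℂ) :
    ren σ (aeval (fun x : Fin n × Fin n => X x + C (a x)) q) =
      aeval (fun x : Fin n × Fin n => X x + C (a x)) (ren σ q) := by
  have h : (ren (K := ℂ) σ).comp (aeval fun x : Fin n × Fin n => X x + C (a x)) =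
      (aeval fun x : Fin n × Fin n => X x + C (a x)).comp (ren σ) := by
    refine MvPolynomial.algHom_ext fun x => ?_
    simp only [AlgHom.comp_apply, aeval_X, map_add, ren_X, ren_C, ha]
  exact congrArg (fun ψ : MvPolynomial (Fin n × Fin n) ℂ →ₐ[ℂ] MvPolynomial (Fin n × Fin n) ℂ => ψ q) h

/-- **INVARIANT TRANSLATION.**  If `p` is restorable at level `c` and `a` is fixed by the diagonal action of
`Sym(Fin n)`, then `p(x + a)` is restorable at level `c + 3`. [folklore] -/
theorem qpOrbitRestorable_translate {c : ℕ} (a : Fin n × Fin n → ℂ)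
    (ha : ∀ (σ : Equiv.Perm (Fin n)) (x : Fin n × Fin n), a (σ • x) = a x)
    {p : MvPolynomial (Fin n × Fin n) ℂ} (hp : QPOrbitRestorable c n p) :
    QPOrbitRestorable (c + 3) n (aeval (fun x : Fin n × Fin n => X x + C (a x)) p) := by
  obtain ⟨hpi, 𝒟, hmem, hS⟩ := exists_valueDerivation_of_qpOrbitRestorable hp
  obtain ⟨𝒟', hmem', hS'⟩ :=
    ValueDerivation.exists_valueDerivation_subst (Γ := Equiv.Perm (Fin n))
      (aeval fun x : Fin n × Fin n => X x + C (a x)) (fun _ => 1) a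
      (fun x => by rw [aeval_X, map_one, one_mul]) (ren_translate_comm a ha) 𝒟 Nat.one_le_two_pow hS
  have hfix : ∀ σ : Equiv.Perm (Fin n),
      ren σ (aeval (fun x : Fin n × Fin n => X x + C (a x)) p) =
        aeval (fun x : Fin n × Fin n => X x + C (a x)) p :=
    fun σ => by rw [ren_translate_comm a ha, hpi]
  unfold QPOrbitRestorable
  exact qpOrbit_of_valueDerivation 𝒟' (hmem' p hmem) hfix hS'

/-- Translating by `a` and then by `-a` is the identity. [folklore] -/
theorem translate_neg_translate (a : Fin n × Fin n → ℂ) (q : MvPolynomial (Fin n × Fin n) ℂ) :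
    aeval (fun x : Fin n × Fin n => X x + C (-a x)) (aeval (fun x : Fin n × Fin n => X x + C (a x)) q) = q := by
  rw [comp_aeval_apply]
  have h : (fun i : Fin n × Fin n => aeval (fun x : Fin n × Fin n => X x + C (-a x)) (X i + C (a i))) =
      fun i => X i := by
    funext i
    simp only [map_add, aeval_X, algHom_C, algebraMap_eq, map_neg]
    ring
  rw [h, aeval_X_left, AlgHom.id_apply]

/-- The constant term of the translate `D(x + a)` is the value `D(a)`. [folklore] -/
theorem constantCoeff_translate (a : Fin n × Fin n → ℂ) (D : MvPolynomial (Fin n × Fin n) ℂ) :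
    constantCoeff (aeval (fun x : Fin n × Fin n => X x + C (a x)) D) = eval a D := by
  induction D using MvPolynomial.induction_on with
  | C c => simp only [algHom_C, algebraMap_eq, constantCoeff_C, eval_C]
  | add p q hp hq => simp only [map_add, hp, hq]
  | mul_X p i hp => simp only [map_mul, hp, aeval_X, map_add, constantCoeff_X, constantCoeff_C, zero_add, eval_X]

/-! ### Division at an invariant base point -/

/-- **DIVISION AT AN INVARIANT BASE POINT.**  If `F = D · h`, `F` and `D` are restorable at level `c`, and `D(a) ≠ 0` at
a point `a` fixed by the diagonal action of `Sym(Fin n)`, then the quotient `h` is restorable at level `c + 38`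
(translate to the origin, divide there, translate back). [cite: Strassen1973, Satz 1] -/
theorem qpOrbitRestorable_of_mul_eq_of_eval_ne_zero {c : ℕ} {F D h : MvPolynomial (Fin n × Fin n) ℂ}
    (hFD : F = D * h) (a : Fin n × Fin n → ℂ) (ha : ∀ (σ : Equiv.Perm (Fin n)) (x : Fin n × Fin n), a (σ • x) = a x)
    (hDa : eval a D ≠ 0) (hF : QPOrbitRestorable c n F) (hD : QPOrbitRestorable c n D) :
    QPOrbitRestorable (c + 38) n h := by
  set τ := aeval (R := ℂ) (fun x : Fin n × Fin n => X x + C (a x)) with hτ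
  have hFD' : τ F = τ D * τ h := by rw [hFD, map_mul]
  have hD0 : constantCoeff (τ D) ≠ 0 := by rw [hτ, constantCoeff_translate]; exact hDa
  have hh : QPOrbitRestorable (c + 3 + 32) n (τ h) :=
    qpOrbitRestorable_of_mul_eq hFD' hD0 (qpOrbitRestorable_translate a ha hF) (qpOrbitRestorable_translate a ha hD)
  have hneg : ∀ (σ : Equiv.Perm (Fin n)) (x : Fin n × Fin n), (fun x => -a x) (σ • x) = (fun x => -a x) x :=
    fun σ x => by simp only [ha]
  have := qpOrbitRestorable_translate (fun x => -a x) hneg hh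
  rwa [hτ, translate_neg_translate] at this

/-- Family form. [cite: Strassen1973, Satz 1] -/
theorem exists_qpOrbitRestorable_of_mul_eq_of_eval_ne_zero {F D h : (n : ℕ) → MvPolynomial (Fin n × Fin n) ℂ}
    (hFD : ∀ n, F n = D n * h n) (a : (n : ℕ) → Fin n × Fin n → ℂ)
    (ha : ∀ (n : ℕ) (σ : Equiv.Perm (Fin n)) (x : Fin n × Fin n), a n (σ • x) = a n x)
    (hDa : ∀ n, eval (a n) (D n) ≠ 0)
    (hF : ∃ c : ℕ, ∀ n, QPOrbitRestorable c n (F n)) (hD : ∃ c : ℕ, ∀ n, QPOrbitRestorable c n (D n)) :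
    ∃ c : ℕ, ∀ n, QPOrbitRestorable c n (h n) := by
  obtain ⟨c₁, h₁⟩ := hF
  obtain ⟨c₂, h₂⟩ := hD
  refine ⟨max c₁ c₂ + 38, fun n => qpOrbitRestorable_of_mul_eq_of_eval_ne_zero (hFD n) (a n) (ha n) (hDa n)
    (Restorable.qpOrbitRestorable_mono (le_max_left _ _) (h₁ n))
    (Restorable.qpOrbitRestorable_mono (le_max_right _ _) (h₂ n))⟩

end ValueOrbitDivision

end Summit.ValiantsHypothesis.ValiantsHypothesis.Theorems

end
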